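import Summits.RiemannHypothesis.RiemannHypothesis.Theorems.PfPersistenceCoefficientRigiditySummableSymbolPrelim
import HarnessLib

/-!
# Coefficient rigidity of window positivity, IX-b: the `ℓ¹` SYMBOL CRITERION
(pub-rhpf cand-7, gen 9/10; mechanism/rigidity campaign; no RH claims)

Ninth part of `PfPersistenceCoefficientRigidity`, second half.  For a weight table `w : ℕ → ℝ`
with absolutely summable defect `c(n) = Λ(n)/√n - w(n)` (entries `n = 0, 1` allowed — they sit at
the origin `log 0 = log 1 = 0`) and SYMBOL `P(t) = ∑_n c(n) cos(t log n)` (part IX-a):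

* `summableEdit_positivity_iff_symbol` — **`ℓ¹` SYMBOL CRITERION (RH-free statement)**:
  `Positivity (tableDatum w) ↔ RiemannHypothesis ∧ ∀ t, 0 ≤ P(t)`.
  (`w = ζ`'s table: Weil's criterion, imported; RH is NOT claimed.)
* `table_lower_bound_iff_of_riemannHypothesis` — under RH the best uniform constant `B` in
  `B‖g‖₂² ≤ Re Q_w(g)` is EXACTLY `2 inf_t P(t)`; `riemannHypothesis_iff_table_lower_bound` — a
  uniform lower bound exists iff RH.
* `exists_window_wavePacket_re_le_of_riemannHypothesis` — the wave-packet witness for `ℓ¹` tables: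
  the finitely-many-sites construction of part VIII-b with the tail of `c` beyond the window
  controlled by part IX-a's `siteSum_range_wavePacket_le`.

This extends part VIII-b (finitely supported perturbations) and part V-b (the `ℓ¹`-isolation
theorem, where the origin entries are frozen) to arbitrary `ℓ¹` perturbations.  ALL STATEMENTS ARE
PROVED (no `sorry`, no new axioms, RH only as an explicit hypothesis or inside a `by_cases`); no
sentence is DATA.

References: E. Bombieri, Rend. Lincei (9) 11 (2000) 183–233, Thm. 1, §2; A. Weil (1952);
H. Yoshida (1992), §2.
-/

set_option linter.dupNamespace false

noncomputable section

open Complex Filter Set MeasureTheory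
open scoped Real Topology ComplexConjugate NNReal

namespace Summit.RiemannHypothesis.RiemannHypothesis.Theorems.PfPersistenceCoefficientRigidity

open Literature.NumberTheory.LFunctions
open Literature.NumberTheory.LFunctions.WeilConverse
open Summit.RiemannHypothesis.RiemannHypothesis.Theorems.PfPersistenceDownCone
open Summit.RiemannHypothesis.RiemannHypothesis.Theorems.PfPersistenceBarrier

/-! ## §51 The wave-packet witness for an `ℓ¹` symbol (RH branch) -/

/-- **RH branch, `ℓ¹` version of part VIII-b §41.**  Under RH, for an absolutely summable
coefficient sequence `c`, every `t₁` and every `ε > 0` there are a wave packet `g_{R,t₀}` (carrier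
`t₀` near `t₁`, off the ordinates) and a window `N` containing its support (`R ≤ ½ log(N+1)`) with
`Re Q_{≤N}(g_{R,t₀}) ≤ (2P(t₁) + ε) · I_R(0)`, where `Q_{≤N}` is the multi-site functional of the
sites `log n`, `n ≤ N`, `P` is the FULL symbol and `I_R(0) = ‖g_{R,t₀}‖₂²`. [this work] -/
theorem exists_window_wavePacket_re_le_of_riemannHypothesis (hRH : RiemannHypothesis) {c : ℕ → ℝ}
    (hsum : Summable fun n ↦ |c n|) (t₁ : ℝ) {ε : ℝ} (hε : 0 < ε) :
    ∃ R t₀ : ℝ, ∃ N : ℕ, 0 < R ∧ R ≤ Real.log ((N : ℝ) + 1) / 2 ∧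
      (multiSiteQuadratic (Finset.range (N + 1)) c (fun n : ℕ ↦ Real.log (n : ℝ))
          (wavePacket R t₀)).re ≤ (2 * tableSymbol c t₁ + ε) * overlap R 0 := by
  -- the tail cut `N₁`
  obtain ⟨N₁, -, hN₁⟩ := exists_absTail_lt c (η := ε / 40) (by positivity)
  -- the carrier: near `t₁` (continuity of the symbol) and off the ordinates
  obtain ⟨δ, hδ, hball⟩ :=
    Metric.continuous_iff.1 (continuous_tableSymbol hsum) t₁ (ε / 8) (by positivity)
  have hab : t₁ - δ / 2 < t₁ + δ / 2 := by linarith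
  obtain ⟨t₀, ht₀, d, hd, hsep⟩ := exists_far_from_ordinates hab
  have hP : tableSymbol c t₀ ≤ tableSymbol c t₁ + ε / 8 := by
    have hdist : dist t₀ t₁ < δ := by
      rw [mem_Icc] at ht₀
      rw [Real.dist_eq, abs_lt]
      constructor <;> linarith
    have h := hball t₀ hdist
    rw [Real.dist_eq, abs_lt] at h
    linarith [h.2]
  -- constants
  obtain ⟨K, hK⟩ := exists_plateau_lipschitz
  have hK0 : (0 : ℝ) ≤ K := K.2
  set A := ∑ n ∈ Finset.range (N₁ + 1), |c n| * |Real.log (n : ℝ)| with hA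
  have hA0 : 0 ≤ A := Finset.sum_nonneg fun i _ ↦ mul_nonneg (abs_nonneg _) (abs_nonneg _)
  set S := ∑' ρ : ZetaZeros.riemannZetaNontrivialZeros, weilZeroWeight (ρ : ℂ) with hSdef
  set M := (weilDecayConst plateauC * ((1 + 2 * t₀ ^ 2) * (2 + 1 / d ^ 2))) ^ 2 with hMdef
  have hS : 0 ≤ S := tsum_nonneg fun ρ ↦ weilZeroWeight_nonneg ρ.2
  have hM : 0 ≤ M := sq_nonneg _
  have hMS : 0 ≤ M * S := mul_nonneg hM hS
  have hKA : 0 ≤ (K : ℝ) * A := mul_nonneg hK0 hA0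
  -- the dilation `R`
  set R := max 1 ((2 * (M * S) + 8 * K * A + 1) / ε) with hRdef
  have hR1 : 1 ≤ R := le_max_left _ _
  have hR0 : 0 < R := by linarith
  have hRε : 2 * (M * S) + 8 * K * A + 1 ≤ ε * R := by
    have h := le_max_right 1 ((2 * (M * S) + 8 * K * A + 1) / ε)
    rw [← hRdef, div_le_iff₀ hε] at h
    linarith
  -- the window `N ≥ N₁` with `R ≤ ½ log(N+1)`
  obtain ⟨N₂, hN₂⟩ := exists_window_le_log_succ_half R
  set N := max N₂ N₁ with hNdef
  have hNN₁ : N₁ ≤ N := le_max_right _ _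
  have hRN : R ≤ Real.log ((N : ℝ) + 1) / 2 := by
    refine hN₂.trans ?_
    have : (N₂ : ℝ) ≤ N := by exact_mod_cast le_max_left _ _
    gcongr
  have hg := isWeilTest_wavePacket hR0 t₀
  have hO0 : R ≤ overlap R 0 := le_overlap_zero hR0
  refine ⟨R, t₀, N, hR0, hRN, ?_⟩
  -- the symbol level on the window: `P_{N+1}(t₀) ≤ P(t₁) + ε/8 + ε/40`
  have hPN : siteSymbol (Finset.range (N + 1)) c (fun n : ℕ ↦ Real.log (n : ℝ)) t₀ ≤
      tableSymbol c t₁ + ε / 8 + ε / 40 := by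
    have h1 := abs_tableSymbol_sub_siteSymbol_le hsum (N + 1) t₀
    have h2 := hN₁ (N + 1) (by omega)
    rw [abs_le] at h1
    linarith [h1.1]
  -- the tail block beyond `N₁`
  have hηsum : ∑ n ∈ Finset.Ico (N₁ + 1) (N + 1), |c n| ≤ ε / 40 :=
    (sum_Ico_abs_le_absTail hsum _ _).trans (hN₁ (N₁ + 1) (by omega)).le
  -- the site-sum estimate of part IX-a
  have hsite := siteSum_range_wavePacket_le (c := c) hR0 t₀ hK hNN₁ hPN hηsum
  rw [← hA] at hsite
  -- the zero side
  rw [multiSiteQuadratic_re, ← combShapeDetection_zeroForm_eq_weilQuadratic hg]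
  simp_rw [re_weilConv_wavePacket_overlap]
  have hZ : (zeroForm (wavePacket R t₀)).re ≤ M / R ^ 2 * S :=
    re_zeroForm_wavePacket_le hRH hR0 hd hsep
  have hZ' : M / R ^ 2 * S ≤ M * S :=
    mul_le_mul_of_nonneg_right (div_le_self hM (by nlinarith)) hS
  -- bookkeeping: `M S + 4 K A ≤ (ε/2) I_R(0) - 1/2`, `8R(ε/40) ≤ (ε/5) I_R(0)`
  have h1 : M * S + 4 * K * A ≤ ε / 2 * overlap R 0 - 1 / 2 := by
    have : ε * R ≤ ε * overlap R 0 := mul_le_mul_of_nonneg_left hO0 hε.le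
    linarith
  have h2 : 8 * R * (ε / 40) ≤ ε / 5 * overlap R 0 := by
    have : ε / 5 * R ≤ ε / 5 * overlap R 0 := mul_le_mul_of_nonneg_left hO0 (by positivity)
    linarith
  have h3 : 0 ≤ ε * overlap R 0 := mul_nonneg hε.le (by linarith)
  have hsplit : 2 * overlap R 0 * (tableSymbol c t₁ + ε / 8 + ε / 40) =
      2 * tableSymbol c t₁ * overlap R 0 + (ε / 4 + ε / 20) * overlap R 0 := by ring
  rw [hsplit] at hsite
  nlinarith [hZ, hZ', hsite, h1, h2, h3]

/-! ## §52 The upper construction for `ℓ¹` tables -/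

/-- **RH branch.**  Under RH, for every `t₁` and `ε > 0` some test function (a wave packet) has
`‖g‖₂ > 0` and `Re Q_w(g) ≤ (2P(t₁) + ε)‖g‖₂²`, `P` the symbol of `Λ/√· - w`. [this work] -/
theorem exists_table_re_le_ratio_of_riemannHypothesis (hRH : RiemannHypothesis) {w : ℕ → ℝ}
    (hsum : Summable fun n ↦ |zetaTable n - w n|) (t₁ : ℝ) {ε : ℝ} (hε : 0 < ε) :
    ∃ g : ℝ → ℂ, IsWeilTest g ∧ 0 < ∫ u, ‖g u‖ ^ 2 ∧
      ((tableDatum w).quadratic g).re ≤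
        (2 * tableSymbol (fun n ↦ zetaTable n - w n) t₁ + ε) * ∫ u, ‖g u‖ ^ 2 := by
  obtain ⟨R, t₀, N, hR0, hRN, hle⟩ :=
    exists_window_wavePacket_re_le_of_riemannHypothesis hRH hsum t₁ hε
  have hg := isWeilTest_wavePacket hR0 t₀
  have hsupp : tsupport (wavePacket R t₀) ⊆
      Icc (-(Real.log ((N : ℝ) + 1) / 2)) (Real.log ((N : ℝ) + 1) / 2) :=
    (tsupport_wavePacket_subset hR0 t₀).trans (Icc_subset_Icc (by linarith) hRN)
  refine ⟨wavePacket R t₀, hg, ?_, ?_⟩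
  · rw [integral_norm_sq_wavePacket]
    linarith [le_overlap_zero hR0]
  · rw [tableDatum_quadratic_eq_multiSite_range w hg hsupp, integral_norm_sq_wavePacket]
    exact hle

/-- **Upper construction (RH-free).**  For every `t₁` and `ε > 0` some test function with
`‖g‖₂ > 0` has `Re Q_w(g) ≤ (2P(t₁) + ε)‖g‖₂²` (RH: wave packets; `¬RH`: sinking ground energy,
part I). [this work] -/
theorem exists_table_re_le_ratio {w : ℕ → ℝ} (hsum : Summable fun n ↦ |zetaTable n - w n|)
    (t₁ : ℝ) {ε : ℝ} (hε : 0 < ε) :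
    ∃ g : ℝ → ℂ, IsWeilTest g ∧ 0 < ∫ u, ‖g u‖ ^ 2 ∧
      ((tableDatum w).quadratic g).re ≤
        (2 * tableSymbol (fun n ↦ zetaTable n - w n) t₁ + ε) * ∫ u, ‖g u‖ ^ 2 := by
  by_cases hRH : RiemannHypothesis
  · exact exists_table_re_le_ratio_of_riemannHypothesis hRH hsum t₁ hε
  · obtain ⟨a, -, -, g, hg, -, hnorm, hW⟩ :=
      exists_weilQuadratic_lt_of_not_riemannHypothesis hRH (4 * ∑' n, |zetaTable n - w n|) 0
    refine ⟨g, hg, by rw [hnorm]; exact one_pos, ?_⟩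
    have h := table_re_le hsum hg
    have hPt := abs_tableSymbol_le hsum t₁
    rw [hnorm] at h ⊢
    linarith [neg_abs_le (tableSymbol (fun n ↦ zetaTable n - w n) t₁)]

/-! ## §53 Under RH the best uniform constant is `2 inf P` -/

/-- Under RH: `2 (inf_t P(t)) ‖g‖₂² ≤ Re Q_w(g)` for every test function (part IX-a's Plancherel
bound and `W(g ⋆ g̃) ≥ 0`, Weil's criterion, imported). [this work] -/
theorem table_re_ge_of_riemannHypothesis (hRH : RiemannHypothesis) {w : ℕ → ℝ}
    (hsum : Summable fun n ↦ |zetaTable n - w n|) {g : ℝ → ℂ} (hg : IsWeilTest g) :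
    2 * (⨅ t, tableSymbol (fun n ↦ zetaTable n - w n) t) * ∫ u, ‖g u‖ ^ 2 ≤
      ((tableDatum w).quadratic g).re := by
  have hW : 0 ≤ (weilQuadratic g).re := by
    rw [← siteQuadratic_zero 0 g]
    exact (siteQuadratic_zero_nonneg_iff_riemannHypothesis 0).2 hRH g hg
  have h := table_re_ge hsum hg
  linarith

/-- **Under RH the uniform lower bounds are exactly `B ≤ 2 inf_t P(t)`:**
`(∀ g test, B‖g‖₂² ≤ Re Q_w(g)) ↔ B ≤ 2 inf P`. [this work] -/
theorem table_lower_bound_iff_of_riemannHypothesis (hRH : RiemannHypothesis) {w : ℕ → ℝ}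
    (hsum : Summable fun n ↦ |zetaTable n - w n|) (B : ℝ) :
    (∀ g : ℝ → ℂ, IsWeilTest g → B * ∫ u, ‖g u‖ ^ 2 ≤ ((tableDatum w).quadratic g).re) ↔
      B ≤ 2 * ⨅ t, tableSymbol (fun n ↦ zetaTable n - w n) t := by
  constructor
  · intro hB
    by_contra h
    push Not at h
    have hlt : (⨅ t, tableSymbol (fun n ↦ zetaTable n - w n) t) < B / 2 := by linarith
    obtain ⟨t₁, ht₁⟩ := exists_lt_of_ciInf_lt hlt
    obtain ⟨g, hg, hm, hq⟩ := exists_table_re_le_ratio_of_riemannHypothesis hRH hsum t₁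
      (by linarith : 0 < (B - 2 * tableSymbol (fun n ↦ zetaTable n - w n) t₁) / 2)
    have h1 := hB g hg
    nlinarith
  · intro hB g hg
    have h := table_re_ge_of_riemannHypothesis hRH hsum hg
    have hm : (0 : ℝ) ≤ ∫ u, ‖g u‖ ^ 2 := integral_nonneg fun u ↦ by positivity
    nlinarith

/-- **Dichotomy**: a uniform lower bound `B‖g‖₂² ≤ Re Q_w(g)` on the test class exists iff RH
(`¬RH`: part IX-a's `riemannHypothesis_of_table_lower_bound`). [this work] -/
theorem riemannHypothesis_iff_table_lower_bound {w : ℕ → ℝ}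
    (hsum : Summable fun n ↦ |zetaTable n - w n|) :
    RiemannHypothesis ↔
      ∃ B : ℝ, ∀ g : ℝ → ℂ, IsWeilTest g → B * ∫ u, ‖g u‖ ^ 2 ≤ ((tableDatum w).quadratic g).re := by
  constructor
  · exact fun hRH ↦ ⟨_, fun g hg ↦ table_re_ge_of_riemannHypothesis hRH hsum hg⟩
  · rintro ⟨B, hB⟩
    exact riemannHypothesis_of_table_lower_bound hsum (B := B) fun g hg _ ↦ hB g hg

/-! ## §54 The `ℓ¹` symbol criterion -/

/-- **`ℓ¹` SYMBOL CRITERION (RH-free statement).**  For a weight table `w` with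
`∑_n |Λ(n)/√n - w(n)| < ∞` (origin entries `n = 0, 1` allowed):
`Positivity (tableDatum w) ↔ RiemannHypothesis ∧ ∀ t, 0 ≤ ∑_n (Λ(n)/√n - w(n)) cos(t log n)`.
(`w = ζ`'s table: Weil's criterion, imported; RH is NOT claimed.) [this work] -/
theorem summableEdit_positivity_iff_symbol {w : ℕ → ℝ}
    (hsum : Summable fun n ↦ |zetaTable n - w n|) :
    (tableDatum w).Positivity ↔
      RiemannHypothesis ∧ ∀ t, 0 ≤ tableSymbol (fun n ↦ zetaTable n - w n) t := by
  unfold ExplicitDatum.Positivity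
  constructor
  · intro h
    refine ⟨riemannHypothesis_of_table_lower_bound hsum (B := 0)
      fun g hg _ ↦ by rw [zero_mul]; exact h g hg, fun t₁ ↦ ?_⟩
    by_contra hneg
    push Not at hneg
    obtain ⟨g, hg, hm, hq⟩ := exists_table_re_le_ratio hsum t₁
      (by linarith : 0 < -tableSymbol (fun n ↦ zetaTable n - w n) t₁)
    have h1 := h g hg
    nlinarith
  · rintro ⟨hRH, hP⟩ g hg
    have h := table_re_ge_of_riemannHypothesis hRH hsum hg
    have hinf : 0 ≤ ⨅ t, tableSymbol (fun n ↦ zetaTable n - w n) t := le_ciInf hP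
    have hm : (0 : ℝ) ≤ ∫ u, ‖g u‖ ^ 2 := integral_nonneg fun u ↦ by positivity
    nlinarith

end Summit.RiemannHypothesis.RiemannHypothesis.Theorems.PfPersistenceCoefficientRigidity

end
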